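import Summits.HodgeConjecture.HodgeConjecture.Theorems.PadicSemiregularLiftHodgeFermatVarietiesExistsFibreOfNotPaired
import Summits.HodgeConjecture.HodgeConjecture.Theorems.PadicSemiregularLiftHodgeFermatVarietiesPairedOfLargePrimesLevel
import Literature.AlgebraicGeometry.HodgeTheory.FermatShiodaCondition
import HarnessLib

/-!
# Length `≤ 6`, both small primes: the progression — line `cancel-by-any-claim-lattice`, crux `HodgeFermatVarieties` (stmt-HodgeConjecture-1334)

Lead c4's programme T6, registered stub T6-L2 `stub_exists_fibre_of_not_paired_le_six_of` (antecedent form): GIVEN the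
level analysis T6-L2a (at a top non-even level `M` of a Hodge character of length `R ≤ 6` at a level prime to `6`, some
`p₁ ∈ {5, 7}` divides `M`, `M ≠ p₁`, and all but one of the `p₁` unit parts `x₀ + j(M/p₁)`, `x₀` a unit, occur at level
`M`), a Hodge multiset `s` of `ℤ/m`, `m` prime to `6`, of length `≤ 6` with `count x s ≠ count (-x) s` for some `x`
contains all but one of the points `A + j(m/p₁)` (`j < p₁`) of a progression with `p₁ A ≠ 0`, for some `p₁ ∈ {5, 7}`
dividing `m`. The argument is that of `…ExistsFibreOfNotPairedPow` with `p₁` PRODUCED by the level analysis instead of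
prescribed: realise `s` as the values of a Hodge character `α : Fin R → ℤ/m` (`R ≤ 6`); the level of an entry with
asymmetric multiplicity is non-even; take the non-even level `M` with the least `m/M` (so every proper multiple of `M`
dividing `m` is even) and apply the level analysis; with `A = (m/M)·⟨x₀⟩` the unit parts `x₀ + j(M/p₁)` lift to
`A + j(m/p₁)` (the lift `x ↦ (m/M)·⟨x⟩` is additive), and `p₁ A = (m/(M/p₁))·⟨x₀⟩ ≠ 0` because `⟨x₀⟩` is prime to `M`
while `M/p₁ > 1` divides `M`.

References: [Aoki1983] N. Aoki, Math. Ann. 266 (1983) 23–54, Thm. A′ (§7), Prop. 2.1.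
-/

-- every sibling file of the line declares into `…CancelByAnyClaimLattice.PairedNull` from a differently named module
set_option linter.dupNamespace false

noncomputable section

open Finset
open Literature.AlgebraicGeometry.HodgeTheory Literature.AlgebraicGeometry.HodgeTheory.FermatCharacter

namespace Summit.HodgeConjecture.HodgeConjecture.Theorems.CancelByAnyClaimLattice

namespace PairedNull

section ProgressionTwin

variable {m : ℕ} [NeZero m]

/-- **T6-L2, named-hypotheses form** — given the level analysis `hL2a` (T6-L2a) at every top non-even level of a Hodge
character of length `≤ 6`, a non-paired Hodge multiset `s` of length `≤ 6` at a level `m` prime to `6` contains all but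
one of the `p₁` points `A + j(m/p₁)` of a progression with `p₁ A ≠ 0`, for some `p₁ ∈ {5, 7}` dividing `m`
(`A = (m/M)·⟨x₀⟩` for the top non-even level `M` and the unit `x₀` of the level analysis).
[cite: Aoki1983, Thm. A′ (§7)] -/
theorem exists_fibre_of_not_paired_le_six_of
    (hL2a : ∀ (R : ℕ), R ≤ 6 → ∀ {m : ℕ} [NeZero m] {α : Fin R → ZMod m}, m.Coprime 6 → FermatCharacter.IsHodge α →
      ∀ {M : ℕ}, M ∣ m →
        (∃ v : ZMod M,
          #(univ.filter fun i : Fin R ↦ m / m.gcd (α i).val = M ∧ ((((α i).val / (m / M)) : ℕ) : ZMod M) = -v) ≠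
          #(univ.filter fun i : Fin R ↦ m / m.gcd (α i).val = M ∧ ((((α i).val / (m / M)) : ℕ) : ZMod M) = v)) →
        (∀ M' : ℕ, M' ∣ m → M ∣ M' → M' ≠ M → ∀ u : ZMod M',
          #(univ.filter fun i : Fin R ↦ m / m.gcd (α i).val = M' ∧ ((((α i).val / (m / M')) : ℕ) : ZMod M') = -u) =
          #(univ.filter fun i : Fin R ↦ m / m.gcd (α i).val = M' ∧ ((((α i).val / (m / M')) : ℕ) : ZMod M') = u)) →
        ∃ p₁ : ℕ, (p₁ = 5 ∨ p₁ = 7) ∧ p₁ ∣ M ∧ M ≠ p₁ ∧ ∃ x₀ : ZMod M, IsUnit x₀ ∧ ∃ j₀ : ℕ, j₀ < p₁ ∧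
          ∀ j : ℕ, j < p₁ → j ≠ j₀ → ∃ i : Fin R, m / m.gcd (α i).val = M ∧
            ((((α i).val / (m / M)) : ℕ) : ZMod M) = x₀ + (j : ZMod M) * ((M / p₁ : ℕ) : ZMod M))
    (hm6 : m.Coprime 6) {s : Multiset (ZMod m)} (hs : IsHodgeMultiset s) (h6 : Multiset.card s ≤ 6)
    (hns : ∃ x : ZMod m, Multiset.count x s ≠ Multiset.count (-x) s) :
    ∃ p₁ : ℕ, (p₁ = 5 ∨ p₁ = 7) ∧ p₁ ∣ m ∧ ∃ A : ZMod m, (p₁ : ZMod m) * A ≠ 0 ∧ ∃ j₀ : ℕ, j₀ < p₁ ∧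
      ∀ j : ℕ, j < p₁ → j ≠ j₀ → A + (j : ZMod m) * ((m / p₁ : ℕ) : ZMod m) ∈ s := by
  classical
  have hm0 : m ≠ 0 := NeZero.ne m
  obtain ⟨r, α, hα, rfl⟩ := hs.exists_isHodge
  rw [card_univ_val_map] at h6
  -- the non-even level of some entry
  obtain ⟨x, hx⟩ := hns
  rw [count_univ_val_map, count_univ_val_map] at hx
  have hx0 : x ≠ 0 := by
    rintro rfl
    rw [neg_zero] at hx
    exact hx rfl
  have hfibre : ∀ (M : ℕ) (y : ZMod m), m / m.gcd y.val = M →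
      (univ.filter fun i : Fin r ↦ α i = y) =
        univ.filter fun i : Fin r ↦ m / m.gcd (α i).val = M ∧
          ((((α i).val / (m / M)) : ℕ) : ZMod M) = (((y.val / (m / M)) : ℕ) : ZMod M) := by
    intro M y hy
    ext i
    simp only [mem_filter, mem_univ, true_and]
    constructor
    · rintro rfl; exact ⟨hy, rfl⟩
    · rintro ⟨hli, hri⟩
      exact eq_of_level_eq_of_unitPart_eq hli hy hri
  set P : ℕ → Prop := fun d ↦ ∃ M : ℕ, M ∣ m ∧ m / M = d ∧ ∃ v : ZMod M,
      #(univ.filter fun i : Fin r ↦ m / m.gcd (α i).val = M ∧ ((((α i).val / (m / M)) : ℕ) : ZMod M) = -v) ≠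
      #(univ.filter fun i : Fin r ↦ m / m.gcd (α i).val = M ∧ ((((α i).val / (m / M)) : ℕ) : ZMod M) = v) with hP
  have hPex : ∃ d, P d := by
    refine ⟨m / (m / m.gcd x.val), m / m.gcd x.val, level_dvd x, rfl, (((x.val / (m / (m / m.gcd x.val))) : ℕ)), ?_⟩
    rw [← unitPart_neg hx0 rfl, ← hfibre _ (-x) (level_neg x), ← hfibre _ x rfl]
    exact Ne.symm hx
  -- the top non-even level `M` (least `d = m / M`)
  obtain ⟨M, hMm, hdM, hne⟩ := Nat.find_spec hPex
  have hM0 : M ≠ 0 := fun h0 ↦ hm0 (by rw [h0] at hMm; exact zero_dvd_iff.mp hMm)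
  have hIH : ∀ M' : ℕ, M' ∣ m → M ∣ M' → M' ≠ M → ∀ u : ZMod M',
      #(univ.filter fun i : Fin r ↦ m / m.gcd (α i).val = M' ∧ ((((α i).val / (m / M')) : ℕ) : ZMod M') = -u) =
      #(univ.filter fun i : Fin r ↦ m / m.gcd (α i).val = M' ∧ ((((α i).val / (m / M')) : ℕ) : ZMod M') = u) := by
    intro M' hM'm hMM' hneM u
    have hM'0 : M' ≠ 0 := fun h0 ↦ hm0 (by rw [h0] at hM'm; exact zero_dvd_iff.mp hM'm)
    have hlt : m / M' < Nat.find hPex := by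
      rw [← hdM]
      obtain ⟨t, rfl⟩ := hMM'
      obtain ⟨s', hs'⟩ := hM'm
      have ht1 : t ≠ 1 := fun h1 ↦ hneM (by rw [h1, mul_one])
      have ht0 : t ≠ 0 := fun h0 ↦ hM'0 (by rw [h0, mul_zero])
      have hs0 : 0 < s' := Nat.pos_of_ne_zero fun h0 ↦ hm0 (by rw [hs', h0, mul_zero])
      have h1 : m / (M * t) = s' := by rw [hs', Nat.mul_div_cancel_left _ (Nat.pos_of_ne_zero hM'0)]
      have h2 : m / M = t * s' := by
        rw [hs', mul_assoc, Nat.mul_div_cancel_left _ (Nat.pos_of_ne_zero hM0)]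
      rw [h1, h2]
      calc s' = 1 * s' := (one_mul s').symm
        _ < t * s' := Nat.mul_lt_mul_of_lt_of_le (by omega) (le_refl s') hs0
    have hmin := Nat.find_min hPex hlt
    simp only [hP, not_exists, not_and, not_not] at hmin
    exact hmin M' hM'm rfl u
  -- the level analysis T6-L2a at the top non-even level produces `p₁ ∈ {5, 7}` and the fibre
  obtain ⟨p₁, hp57, hpM, hMp, x₀, hx₀u, j₀, hj₀, hfib⟩ := hL2a r h6 hm6 hα hMm hne hIH
  haveI : NeZero M := ⟨hM0⟩
  have hpm : p₁ ∣ m := hpM.trans hMm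
  obtain ⟨M', hM'⟩ := hpM
  obtain ⟨k, hk⟩ := hMm
  have hp0 : 0 < p₁ := by rcases hp57 with rfl | rfl <;> norm_num
  have hM'0 : M' ≠ 0 := fun h0 ↦ hM0 (by rw [hM', h0, mul_zero])
  have hdivM : M / p₁ = M' := by rw [hM', Nat.mul_div_cancel_left _ hp0]
  have hdivm : m / M = k := by rw [hk, Nat.mul_div_cancel_left _ (Nat.pos_of_ne_zero hM0)]
  have hdivp : m / p₁ = M' * k := by rw [hk, hM', mul_assoc, Nat.mul_div_cancel_left _ hp0]
  have hdivM' : m / M' = p₁ * k := by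
    rw [hk, hM', show p₁ * M' * k = M' * (p₁ * k) by ring, Nat.mul_div_cancel_left _ (Nat.pos_of_ne_zero hM'0)]
  have hM'm : M' ∣ m := ⟨p₁ * k, by rw [hk, hM']; ring⟩
  have hM'1 : M' ≠ 1 := fun h1 ↦ hMp (by rw [hM', h1, mul_one])
  refine ⟨p₁, hp57, hpm, ((m / M : ℕ) : ZMod m) * ((x₀.val : ℕ) : ZMod m), ?_, j₀, hj₀, fun j hj hjj ↦ ?_⟩
  · -- `p₁ A ≠ 0`: `p₁ A = (m/M')·⟨x₀⟩` and `M' ∤ ⟨x₀⟩` as `x₀` is a unit mod `M = p₁ M'`, `M' > 1`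
    intro h0
    have h5A : (p₁ : ZMod m) * (((m / M : ℕ) : ZMod m) * ((x₀.val : ℕ) : ZMod m)) = ((m / M' * x₀.val : ℕ) : ZMod m) := by
      rw [hdivM', hdivm]; push_cast; ring
    rw [h5A, divMul_natCast_eq_zero_iff hM'm] at h0
    have hcop : Nat.Coprime x₀.val M := by
      have := ZMod.val_coe_unit_coprime hx₀u.unit
      rwa [IsUnit.unit_spec] at this
    have hg : M' ∣ Nat.gcd x₀.val M := Nat.dvd_gcd h0 ⟨p₁, by rw [hM', mul_comm]⟩
    rw [Nat.Coprime.gcd_eq_one hcop] at hg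
    exact hM'1 (Nat.dvd_one.mp hg)
  · obtain ⟨i, hlev, hup⟩ := hfib j hj hjj
    have hαi : α i = ((m / M : ℕ) : ZMod m) * ((x₀.val : ℕ) : ZMod m) + (j : ZMod m) * ((m / p₁ : ℕ) : ZMod m) := by
      rw [eq_divMul_unitPart hlev, hup, show (j : ZMod M) * ((M / p₁ : ℕ) : ZMod M) = ((j * (M / p₁) : ℕ) : ZMod M) by
        push_cast; ring, divMul_val_add ⟨k, hk⟩]
      congr 1
      have hval : (((j * (M / p₁) : ℕ) : ZMod M)).val = j * (M / p₁) := by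
        rw [ZMod.val_natCast, Nat.mod_eq_of_lt]
        rw [hdivM, hM']
        calc j * M' < p₁ * M' := Nat.mul_lt_mul_of_pos_right hj (Nat.pos_of_ne_zero hM'0)
          _ = p₁ * M' := rfl
      rw [hval, hdivM, hdivm, hdivp]
      push_cast
      ring
    rw [← hαi]
    exact Multiset.mem_map_of_mem _ (Finset.mem_univ_val i)

/-- **T6-L2 `stub_exists_fibre_of_not_paired_le_six_of`** — the registered one-line form: the level analysis T6-L2a
(as an antecedent) implies the progression at length `≤ 6` with both small primes allowed
(`exists_fibre_of_not_paired_le_six_of`). [cite: Aoki1983, Thm. A′ (§7)] -/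
theorem stub_exists_fibre_of_not_paired_le_six_of : (∀ (R : ℕ), R ≤ 6 → ∀ {m : ℕ} [NeZero m] {α : Fin R → ZMod m}, m.Coprime 6 → FermatCharacter.IsHodge α → ∀ {M : ℕ}, M ∣ m → (∃ v : ZMod M, #(univ.filter fun i : Fin R ↦ m / m.gcd (α i).val = M ∧ ((((α i).val / (m / M)) : ℕ) : ZMod M) = -v) ≠ #(univ.filter fun i : Fin R ↦ m / m.gcd (α i).val = M ∧ ((((α i).val / (m / M)) : ℕ) : ZMod M) = v)) → (∀ M' : ℕ, M' ∣ m → M ∣ M' → M' ≠ M → ∀ u : ZMod M', #(univ.filter fun i : Fin R ↦ m / m.gcd (α i).val = M' ∧ ((((α i).val / (m / M')) : ℕ) : ZMod M') = -u) = #(univ.filter fun i : Fin R ↦ m / m.gcd (α i).val = M' ∧ ((((α i).val / (m / M')) : ℕ) : ZMod M') = u)) → ∃ p₁ : ℕ, (p₁ = 5 ∨ p₁ = 7) ∧ p₁ ∣ M ∧ M ≠ p₁ ∧ ∃ x₀ : ZMod M, IsUnit x₀ ∧ ∃ j₀ : ℕ, j₀ < p₁ ∧ ∀ j : ℕ, j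 < p₁ → j ≠ j₀ → ∃ i : Fin R, m / m.gcd (α i).val = M ∧ ((((α i).val / (m / M)) : ℕ) : ZMod M) = x₀ + (j : ZMod M) * ((M / p₁ : ℕ) : ZMod M)) → ∀ (m : ℕ) [NeZero m], m.Coprime 6 → ∀ s : Multiset (ZMod m), IsHodgeMultiset s → Multiset.card s ≤ 6 → (∃ x : ZMod m, Multiset.count x s ≠ Multiset.count (-x) s) → ∃ p₁ : ℕ, (p₁ = 5 ∨ p₁ = 7) ∧ p₁ ∣ m ∧ ∃ A : ZMod m, (p₁ : ZMod m) * A ≠ 0 ∧ ∃ j₀ : ℕ, j₀ < p₁ ∧ ∀ j : ℕ, j < p₁ → j ≠ j₀ → A + (j : ZMod m) * ((m / p₁ : ℕ) : ZMod m) ∈ s :=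
  fun hL2a _ _ hm6 _ hs h6 hns ↦ exists_fibre_of_not_paired_le_six_of hL2a hm6 hs h6 hns

end ProgressionTwin

end PairedNull

end Summit.HodgeConjecture.HodgeConjecture.Theorems.CancelByAnyClaimLattice

end
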